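/-
Copyright (c) 2026 the pub-hodgecm-mathlib formalisation cell (harness21).  Prover seat hodgecm-mathlib-LH7-p05 (g0), req620 Track A «(D-RAM) FOUR-FRAME» squad, helper lane on
h413 = stmt-HodgeConjecture-24833 (count-neutral).  β-BOARD v1 row R7 «GLUE CLASSES», Theorem C bricks L3a∕L3b∕L3d (ROADMAP-R7-TheoremC v1 d79581c1; sub-dealer LH4-p05 (g8)
ruling 15:31:23Z).  2026-09-04.
-/
import Summits.HodgeConjecture.HodgeConjecture.Theorems.F0P3cDyRamLabelledOddClassSignSubgroup   -- ★ p860847 (LH4-p13 (g8)) (L-lab-20d) + ★ (L-lab-20b) + ★ OneSlotRead (`map_unitNormMap_unitStabilizer_le`)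
import Summits.HodgeConjecture.HodgeConjecture.Theorems.F0P3cDyRamTwoSlotLabelReadGlued
import Summits.HodgeConjecture.HodgeConjecture.Theorems.F0P3cDyRamGluedProductTransversal
import Summits.HodgeConjecture.HodgeConjecture.Theorems.F0P3cDyRamDiagonalOrbitFibreTransport
import Summits.HodgeConjecture.HodgeConjecture.Theorems.F0P3cDyRamValueClassLabelEquivariant
import Summits.HodgeConjecture.HodgeConjecture.Theorems.F0P3cDyRamDiagonalOrbitFibreCountHeads
import Summits.HodgeConjecture.HodgeConjecture.Theorems.F0P3cDyRamStableCountTypeZero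
import Literature.NumberTheory.Automorphic.UnitaryLatticeTreeWeightedGauss                        -- ★ `v_eq_one_of_v_sub_one_lt_one`
import Literature.NumberTheory.LocalFields.WildQuadraticDatumNonNormUnit
import Literature.NumberTheory.LocalFields.WildQuadraticDatumNormSignConductor
import HarnessLib

/-!
# Crux `H413`, line LH4 «(D-RAM) FOUR-FRAME» — (β) Stage B, β-BOARD row R7 Theorem C, bricks L3 (FILE 1 of 2): transversal bookkeeping and ★ p860847 INSTANTIATED ON THE
# GLUED REPRESENTATIVE `latt V(1,1,g)` OVER ★ PT-3's PRODUCT TRANSVERSAL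

Cell `hodgecm-mathlib` (D-0151), FLOOR 0, crux item H413 = `stmt-HodgeConjecture-24833`, route `HCCMUnconditional`; squad F0∕P3c∕LH4 (β-table fan, sub-dealer LH4-p05 (g8)).
THEOREMS ONLY (no `def`, no instance, no notation, no `sorry`, default heartbeats); ★-only imports; lane `--supports stmt-HodgeConjecture-24833 --as helper` (count-neutral);
pays NO row, states NO law.  ROADMAP-R7-TheoremC v1 d79581c1 bricks L3a∕L3d; FILE 2 (`…GluedRepClassSumHead`) carries L3b and the HEAD.
THE MATHEMATICS ([Kottwitz1986BaseChangeUnits, §1]; [LanglandsShelstad1987, §3]; [Rogawski1990, §4.9 Prop. 4.9.1 (b)]).  For `V = V(1,1,g)` (`σg = g`, `|g| = |ϖ|^{2t}`,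
`ρ, t ≥ 1`) on the clean shell of `X = diag(α−1, β−1, 0)`, ★ p860847 (LH4-p13, (L-lab-20d)) computes `2·#(R₀∩N′)·lOC_i` over any transversal `R₀` of `S_F ∕ N₀`, `N₀ ≤ N′ = N(S̃)`;
★ PT-3 (LH4-p09) supplies the PRODUCT transversal `R₀ = A₀ × Aβ × Aγ` of `S_F ∕ N(D(ρ,t))` (`r = a₀·(1, ψ, ψ·aβ)`, `ψ = aγ·T(aβ)⁻¹`, `T(y) = y + g⁻¹(y−1)`); ★
`valueClassLabel_glued_rep_class_iff_normSign` (LH4-p13) reads the label of the class `D(g)·u` as `ω(u₀·g·g_α + u₁·g_β)` (tokens at precision `m*` against `D(g)`, ★ p861295).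
* §0 `card_eq_relIndex_of_transversal` (a Finset transversal of `S ∕ N` has `[S : N]` elements), `exists_transversal_of_relIndex_ne_zero`.
* §1 LEMMA A `two_mul_card_mul_labelledOddCount_glued_rep_eq_sum`: `2·#(R₀∩N′)·lOC_i(latt V) = ω(D(g)_i)·Σ_{r ∈ R₀} ω(r_i)(1 + ω(r₀ g g_α + r₁ g_β))`.
HONEST LABEL: count-neutral bookkeeping; R7 C ∕ hRest ∕ (β-BAL) ∕ (β) ∕ T₊ OPEN; `HC_CM` is proved only modulo the 7 printed citations (2 remaining named inputs: hLiu418 =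
`stmt-HodgeConjecture-24832`, h413 = `stmt-HodgeConjecture-24833`) until rung 0 closes.
References: [Kottwitz1986BaseChangeUnits] §1 pp. 240–241 · [LanglandsShelstad1987] §3 · [Rogawski1990] §4.9 Prop. 4.9.1 (a)(b) p. 55 · [Serre1979] Ch. V §3 Cor. 3, Ch. VI §1.
-/

set_option autoImplicit false

noncomputable section

namespace Summit.HodgeConjecture.HodgeConjecture.Cruxes.H413.F0P3cDyRamLabelledOddGluedRepClassSum

open Matrix WithZero
open Literature.NumberTheory.Automorphic Literature.NumberTheory.Automorphic.HermitianLattice Literature.NumberTheory.Automorphic.UnitaryGroup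
open Literature.NumberTheory.Automorphic.UnitaryLatticeTree Literature.NumberTheory.Automorphic.UnitaryThreeFourFrame
open Literature.NumberTheory.LocalFields Literature.NumberTheory.LocalFields.WildQuadraticDatum
open Summit.HodgeConjecture.HodgeConjecture.Cruxes.H413.F0P3cDyRamFourFramePieces
open Summit.HodgeConjecture.HodgeConjecture.Cruxes.H413.F0P3cDyRamFourFrameCensusDefs
open Summit.HodgeConjecture.HodgeConjecture.Cruxes.H413.F0P3cDyRamDiagonalTorusDefs
open Summit.HodgeConjecture.HodgeConjecture.Cruxes.H413.F0P3cDyRamLabelledOddCountDefs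
open Summit.HodgeConjecture.HodgeConjecture.Cruxes.H413.F0P3cDyRamLabelledOddClassSignSubgroup (two_mul_card_mul_labelledOddCount_eq_sum_of_classSign)
open Summit.HodgeConjecture.HodgeConjecture.Cruxes.H413.F0P3cDyRamLabelledOddClassSignRead (label_mul_norm_iff_of_isTorusEquivariantLabel)
open Summit.HodgeConjecture.HodgeConjecture.Cruxes.H413.F0P3cDyRamLabelledOddOneSlotRead (map_unitNormMap_unitStabilizer_le)
open Summit.HodgeConjecture.HodgeConjecture.Cruxes.H413.F0P3cDyRamDiagonalLabelledOddOrbitCount (relIndex_map_unitNormMap_unitStabilizer_ne_zero)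
open Summit.HodgeConjecture.HodgeConjecture.Cruxes.H413.F0P3cDyRamTwoSlotLabelReadGlued (valueClassLabel_glued_rep_class_iff_normSign)
open Summit.HodgeConjecture.HodgeConjecture.Cruxes.H413.F0P3cDyRamDiagonalKappaGluedClassForm (isVertexLattice_zero_latt_glued_rep)
open Summit.HodgeConjecture.HodgeConjecture.Cruxes.H413.F0P3cDyRamDiagonalOrbitFibreTransport (fibre_isCoset_zero)
open Summit.HodgeConjecture.HodgeConjecture.Cruxes.H413.F0P3cDyRamValueClassLabelEquivariant (isTorusEquivariantLabel_valueClassLabel)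
open Summit.HodgeConjecture.HodgeConjecture.Cruxes.H413.F0P3cDyRamGluedDeepRatioSubgroup (exists_deepRatioSubgroup map_deepRatioSubgroup_le_map_unitStabilizer_glued_rep v_T_sub_one_le)
open Summit.HodgeConjecture.HodgeConjecture.Cruxes.H413.F0P3cDyRamGluedProductTransversal (productTransversal_glued_rep exists_productTransversal)
open Summit.HodgeConjecture.HodgeConjecture.Cruxes.H413.F0P3cDyRamDiagonalOrbitFibreCountHeads (finite_unitTorus_orbit_of_mem_normalisedStableLattices)
open Summit.HodgeConjecture.HodgeConjecture.Cruxes.H413.F0P3cDyRamStableCountTypeZero (v_diag_eq_one diag_regular)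
open Summit.HodgeConjecture.HodgeConjecture.Cruxes.H413.F0P3cDyRamDiagonalOrbitAveraging (relIndex_fixedUnitStabilizer_ne_zero_of_finite)
open scoped Valued WithZero Matrix MatrixGroups

variable {K : Type} [Field K] [Valued K ℤᵐ⁰]

section Generic

variable {G : Type*} [CommGroup G]

/-! ## §0  Transversals: cardinality = relative index; existence -/

open Classical in
/-- **A FINSET TRANSVERSAL OF `S ∕ N` HAS `[S : N]` ELEMENTS** (commutative group; `R ⊆ S`, `∀ u ∈ S, ∃! r ∈ R, u⁻¹r ∈ N`): the class map `R → S ⧸ N` is a bijection.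
[cite: Serre1979, Ch. VI §1] -/
theorem card_eq_relIndex_of_transversal {S N : Subgroup G}
    (R : Finset G) (hRS : ∀ r ∈ R, r ∈ S) (hR : ∀ u ∈ S, ∃! r, r ∈ R ∧ u⁻¹ * r ∈ N) :
    R.card = N.relIndex S := by
  classical
  set H : Subgroup S := N.subgroupOf S with hH
  let f : R → S ⧸ H := fun r => QuotientGroup.mk (⟨r.1, hRS r.1 r.2⟩ : S)
  have hf : Function.Bijective f := by
    constructor
    · rintro ⟨r, hr⟩ ⟨r', hr'⟩ h
      have h' : (⟨r, hRS r hr⟩ : S)⁻¹ * ⟨r', hRS r' hr'⟩ ∈ H := QuotientGroup.eq.1 h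
      rw [hH, Subgroup.mem_subgroupOf] at h'
      obtain ⟨r₀, -, huniq⟩ := hR r (hRS r hr)
      have e1 : r = r₀ := huniq r ⟨hr, by rw [inv_mul_cancel]; exact one_mem N⟩
      have e2 : r' = r₀ := huniq r' ⟨hr', by simpa using h'⟩
      exact Subtype.ext (e1.trans e2.symm)
    · intro q
      obtain ⟨u, rfl⟩ := QuotientGroup.mk_surjective q
      obtain ⟨r, ⟨hr, hur⟩, -⟩ := hR u.1 u.2
      refine ⟨⟨r, hr⟩, ?_⟩
      apply Eq.symm
      apply QuotientGroup.eq.2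
      rw [hH, Subgroup.mem_subgroupOf]
      simpa using hur
  have h1 : Nat.card R = Nat.card (S ⧸ H) := Nat.card_eq_of_bijective f hf
  rw [Subgroup.relIndex, ← hH, Subgroup.index, ← h1, Nat.card_eq_fintype_card, Fintype.card_coe]

open Classical in
/-- **A FINSET TRANSVERSAL OF `S ∕ N` EXISTS** when `[S : N] ≠ 0` (representatives `Quotient.out` of the finite quotient). [cite: Serre1979, Ch. VI §1] -/
theorem exists_transversal_of_relIndex_ne_zero {S N : Subgroup G} (hidx : N.relIndex S ≠ 0) :
    ∃ R : Finset G, (∀ r ∈ R, r ∈ S) ∧ ∀ u ∈ S, ∃! r, r ∈ R ∧ u⁻¹ * r ∈ N := by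
  classical
  have hidx' : (N.subgroupOf S).index ≠ 0 := hidx
  haveI : Fintype (S ⧸ N.subgroupOf S) := Subgroup.fintypeOfIndexNeZero hidx'
  refine ⟨(Finset.univ : Finset (S ⧸ N.subgroupOf S)).image (fun q => ((Quotient.out q : S) : G)), ?_, ?_⟩
  · intro r hr
    obtain ⟨q, -, rfl⟩ := Finset.mem_image.1 hr
    exact (Quotient.out q).2
  · intro u hu
    have hout : ∀ q : S ⧸ N.subgroupOf S, (QuotientGroup.mk (Quotient.out q) : S ⧸ N.subgroupOf S) = q := fun q => Quotient.out_eq q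
    refine ⟨((Quotient.out (QuotientGroup.mk (⟨u, hu⟩ : S) : S ⧸ N.subgroupOf S) : S) : G),
      ⟨Finset.mem_image.2 ⟨_, Finset.mem_univ _, rfl⟩, ?_⟩, ?_⟩
    · have h : (⟨u, hu⟩ : S)⁻¹ * Quotient.out (QuotientGroup.mk (⟨u, hu⟩ : S) : S ⧸ N.subgroupOf S) ∈ N.subgroupOf S :=
        QuotientGroup.eq.1 (hout _).symm
      rw [Subgroup.mem_subgroupOf] at h
      simpa using h
    · rintro r ⟨hr, hur⟩
      obtain ⟨q, -, rfl⟩ := Finset.mem_image.1 hr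
      have hmem : (⟨u, hu⟩ : S)⁻¹ * Quotient.out q ∈ N.subgroupOf S := by
        rw [Subgroup.mem_subgroupOf]; simpa using hur
      have hq : q = (QuotientGroup.mk (⟨u, hu⟩ : S) : S ⧸ N.subgroupOf S) := by
        rw [← hout q]
        exact (QuotientGroup.eq.2 hmem).symm
      rw [hq]

end Generic

/-! ## §0b  Letters of the explicit polarisation `D(g) = π₀^{−(ρ+t)}·(g, 1, −(1+g)⁻¹)` -/

omit [Valued K ℤᵐ⁰] in
/-- The explicit polarisation `D(g)` of ★ κG-A1 has `σ`-fixed non-zero entries (`σ g = g`, `g ≠ 0`, `1 + g ≠ 0`). [cite: Kottwitz1986BaseChangeUnits, §1 pp. 240–241] -/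
theorem glued_rep_polarisation_fixed_ne_zero {σ : K →+* K} (hσ : ∀ a, σ (σ a) = a) {ϖ : K} (hϖ0 : ϖ ≠ 0) (ρ t' : ℕ) {g : K} (hσg : σ g = g)
    (hg0 : g ≠ 0) (h1g0 : 1 + g ≠ 0) :
    ∀ j, σ ((![((ϖ * σ ϖ) ^ (ρ + t'))⁻¹ * g, ((ϖ * σ ϖ) ^ (ρ + t'))⁻¹, -(((ϖ * σ ϖ) ^ (ρ + t'))⁻¹ * (1 + g)⁻¹)] : Fin 3 → K) j) =
      (![((ϖ * σ ϖ) ^ (ρ + t'))⁻¹ * g, ((ϖ * σ ϖ) ^ (ρ + t'))⁻¹, -(((ϖ * σ ϖ) ^ (ρ + t'))⁻¹ * (1 + g)⁻¹)] : Fin 3 → K) j ∧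
      (![((ϖ * σ ϖ) ^ (ρ + t'))⁻¹ * g, ((ϖ * σ ϖ) ^ (ρ + t'))⁻¹, -(((ϖ * σ ϖ) ^ (ρ + t'))⁻¹ * (1 + g)⁻¹)] : Fin 3 → K) j ≠ 0 := by
  have hσϖ0 : σ ϖ ≠ 0 := (map_ne_zero σ).2 hϖ0
  have hπ0 : ((ϖ * σ ϖ) ^ (ρ + t') : K) ≠ 0 := pow_ne_zero _ (mul_ne_zero hϖ0 hσϖ0)
  have hσπ : σ ((ϖ * σ ϖ) ^ (ρ + t')) = (ϖ * σ ϖ) ^ (ρ + t') := by rw [map_pow, map_mul, hσ, mul_comm]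
  intro j
  fin_cases j
  · simp only [Fin.zero_eta, Fin.isValue, Matrix.cons_val_zero]
    exact ⟨by rw [map_mul, map_inv₀, hσπ, hσg], mul_ne_zero (inv_ne_zero hπ0) hg0⟩
  · simp only [Fin.mk_one, Fin.isValue, Matrix.cons_val_one, Matrix.cons_val_zero]
    exact ⟨by rw [map_inv₀, hσπ], inv_ne_zero hπ0⟩
  · simp only [Fin.reduceFinMk, Matrix.cons_val_two, Matrix.tail_cons, Matrix.head_cons]
    exact ⟨by rw [map_neg, map_mul, map_inv₀, map_inv₀, hσπ, map_add, map_one, hσg],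
      neg_ne_zero.2 (mul_ne_zero (inv_ne_zero hπ0) (inv_ne_zero h1g0))⟩

/-! ## §1  The class-sign formula on the glued representative over the product transversal -/

section Rep

variable [CompleteSpace K] [Fintype 𝓀[K]] {σ : K →+* K} {ϖ : K} {d t : ℕ} {α β : K} {N₀ n₁ n₂ n₃ : ℕ}

open Classical in
/-- **LEMMA A — THE CLASS-SIGN FORMULA ON THE GLUED REPRESENTATIVE OVER THE PRODUCT TRANSVERSAL**: ★ p860847 instantiated on `latt V(1,1,g)` (clean shell, `T`-stable) with
★ PT-3's product transversal `R₀` of `S_F ∕ N(D(ρ,t))` and the label read ★ `valueClassLabel_glued_rep_class_iff_normSign`: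
`2·#(R₀∩N′)·lOC_i(latt V) = ω(D(g)_i)·Σ_{r ∈ R₀} ω(r_i)(1 + ω(r₀ g g_α + r₁ g_β))`. [cite: Kottwitz1986BaseChangeUnits, §1 pp. 240–241] [cite: LanglandsShelstad1987, §3]
[cite: Rogawski1990, §4.9 Prop. 4.9.1 (b) p. 55] -/
theorem two_mul_card_mul_labelledOddCount_glued_rep_eq_sum (hD : IsRamifiedQuadraticDatum σ ϖ d t)
    {ρ t' : ℕ} (hρ : 1 ≤ ρ) (ht' : 1 ≤ t') {g : K} (hσg : σ g = g) (hg : Valued.v g = Valued.v ϖ ^ (2 * t'))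
    (V : GL (Fin 3) K) (hV : (V : Matrix (Fin 3) (Fin 3) K) = !![1, 0, 0; 1, ϖ ^ ρ, 0; 1 * 1 + g, ϖ ^ ρ * 1, ϖ ^ (2 * ρ + 2 * t')])
    (hn : IsNormalisedLattice (latt (V : Matrix (Fin 3) (Fin 3) K)))
    (hE : IsElementDatum σ ϖ N₀ α β n₁ n₂ n₃) {mc : ℕ} (hℓN : d % 2 + 1 ≤ N₀) (hmN : d % 2 + 2 * d - 1 ≤ N₀)
    (hℓmc : 2 * (d % 2) + 1 ≤ mc) (hmmc : d % 2 + 2 * d - 1 + d % 2 ≤ mc)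
    (hlev : LatticeInLevel ϖ (d % 2) (Matrix.diagonal ![α - 1, β - 1, 0]) (latt (V : Matrix (Fin 3) (Fin 3) K)))
    (hnlev : ¬ LatticeInLevel ϖ (d % 2 + 1) (Matrix.diagonal ![α - 1, β - 1, 0]) (latt (V : Matrix (Fin 3) (Fin 3) K)))
    (hsq : LatticeInLevel ϖ mc (Matrix.diagonal ![(α - 1) * (α - 1), (β - 1) * (β - 1), 0]) (latt (V : Matrix (Fin 3) (Fin 3) K)))
    {T : GL (Fin 3) K} (hT : (T : Matrix (Fin 3) (Fin 3) K) = Matrix.diagonal ![α, β, 1])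
    (hTM : mapGL T (latt (V : Matrix (Fin 3) (Fin 3) K)) = latt (V : Matrix (Fin 3) (Fin 3) K))
    {gα gβ : K} (hσgα : σ gα = gα) (hσgβ : σ gβ = gβ)
    (hgα : Valued.v ((ϖ ^ (d % 2 + 2 * d - 1))⁻¹ * (((ϖ * σ ϖ) ^ (ρ + t'))⁻¹ * g * ((α - 1) - gα * ((ϖ - σ ϖ) * ((ϖ * σ ϖ) ^ ((d - d % 2) / 2))⁻¹)))) ≤ 1)
    (hgβ : Valued.v ((ϖ ^ (d % 2 + 2 * d - 1))⁻¹ * (((ϖ * σ ϖ) ^ (ρ + t'))⁻¹ * ((β - 1) - gβ * ((ϖ - σ ϖ) * ((ϖ * σ ϖ) ^ ((d - d % 2) / 2))⁻¹)))) ≤ 1)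
    {c : K} (hσc : σ c = c) (hcv : Valued.v c = 1) (hc : ¬ ∃ z : K, z * σ z = c)
    (hdich : ∀ x : K, σ x = x → x ≠ 0 → (∃ z : K, z * σ z = x) ∨ ∃ z : K, z * σ z = c * x)
    (A₀ Aβ Aγ : Finset K)
    (hA₀sub : ∀ a ∈ A₀, σ a = a ∧ Valued.v a = 1)
    (hA₀ : ∀ x : K, σ x = x → Valued.v x = 1 → ∃! a, a ∈ A₀ ∧ ∃ e : K, Valued.v e = 1 ∧ e * σ e = a / x)
    (hAγsub : ∀ a ∈ Aγ, σ a = a ∧ Valued.v (a - 1) ≤ Valued.v ϖ ^ (2 * ρ))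
    (hAγ : ∀ p : K, σ p = p → Valued.v (p - 1) ≤ Valued.v ϖ ^ (2 * ρ) →
      ∃! a, a ∈ Aγ ∧ ∃ w : K, Valued.v (w - 1) ≤ Valued.v ϖ ^ (2 * ρ) ∧ w * σ w = a / p)
    (hAβsub : ∀ a ∈ Aβ, σ a = a ∧ Valued.v (a - 1) ≤ Valued.v ϖ ^ (ρ + 2 * t'))
    (hAβ : ∀ y : K, σ y = y → Valued.v (y - 1) ≤ Valued.v ϖ ^ (ρ + 2 * t') →
      ∃! a, a ∈ Aβ ∧ ∃ s : K, Valued.v (s - 1) ≤ Valued.v ϖ ^ (2 * ρ + 2 * t') ∧ s * σ s = a / y)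
    (R₀ : Finset (Fin 3 → Kˣ))
    (hR₀ : ∀ r : Fin 3 → Kˣ, r ∈ R₀ ↔ ∃ a₀ ∈ A₀, ∃ aβ ∈ Aβ, ∃ aγ ∈ Aγ,
      (r 0 : K) = a₀ ∧ (r 1 : K) = a₀ * (aγ * (aβ + g⁻¹ * (aβ - 1))⁻¹) ∧ (r 2 : K) = a₀ * (aγ * (aβ + g⁻¹ * (aβ - 1))⁻¹) * aβ)
    {Dρ : Subgroup (Fin 3 → Kˣ)} (hDρ : ∀ s : Fin 3 → Kˣ, s ∈ Dρ ↔
      (∀ i, Valued.v (s i : K) = 1) ∧ Valued.v ((s 1 : K) - s 0) ≤ Valued.v ϖ ^ (2 * ρ) ∧ Valued.v ((s 2 : K) - s 1) ≤ Valued.v ϖ ^ (2 * ρ + 2 * t'))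
    (i : Fin 3) :
    2 * ((R₀.filter fun r => r ∈ (unitStabilizer (latt (V : Matrix (Fin 3) (Fin 3) K))).map (unitNormMap σ 3)).card : ℤ) *
        labelledOddCount σ ϖ 0 i (valueClassLabel σ ϖ (α - 1) (β - 1) (d % 2 + 2 * d - 1) d) (latt (V : Matrix (Fin 3) (Fin 3) K)) =
      normSign σ ((![((ϖ * σ ϖ) ^ (ρ + t'))⁻¹ * g, ((ϖ * σ ϖ) ^ (ρ + t'))⁻¹, -(((ϖ * σ ϖ) ^ (ρ + t'))⁻¹ * (1 + g)⁻¹)] : Fin 3 → K) i) *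
        ∑ r ∈ R₀, normSign σ ((r i : Kˣ) : K) * (1 + normSign σ (((r 0 : Kˣ) : K) * g * gα + ((r 1 : Kˣ) : K) * gβ)) := by
  classical
  have hD' := hD
  obtain ⟨hσ, hvσ, hϖ, hfix, -, -, -⟩ := hD'
  have hϖ0 : ϖ ≠ 0 := fun h0 => by rw [h0, map_zero] at hϖ; exact WithZero.coe_ne_zero hϖ.symm
  have hϖ1 : Valued.v ϖ < 1 := by rw [hϖ, ← WithZero.exp_zero, WithZero.exp_lt_exp]; norm_num
  have hσϖ0 : σ ϖ ≠ 0 := (map_ne_zero σ).2 hϖ0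
  have hπ0 : ((ϖ * σ ϖ) ^ (ρ + t') : K) ≠ 0 := pow_ne_zero _ (mul_ne_zero hϖ0 hσϖ0)
  have hσπ : σ ((ϖ * σ ϖ) ^ (ρ + t')) = (ϖ * σ ϖ) ^ (ρ + t') := by rw [map_pow, map_mul, hσ, mul_comm]
  have hg1 : Valued.v g < 1 := by rw [hg]; exact pow_lt_one₀ zero_le hϖ1 (by omega)
  have hg0 : g ≠ 0 := fun h => by
    rw [h, map_zero] at hg; exact (pow_ne_zero _ ((Valuation.ne_zero_iff Valued.v).2 hϖ0)) hg.symm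
  have h1g : Valued.v (1 + g) = 1 := Valued.v.map_one_add_of_lt hg1
  have h1g0 : 1 + g ≠ 0 := fun h => by rw [h, map_zero] at h1g; exact zero_ne_one h1g
  -- the polarisation `D(g)` (★ κG-A1)
  set D₁ : Fin 3 → K := ![((ϖ * σ ϖ) ^ (ρ + t'))⁻¹ * g, ((ϖ * σ ϖ) ^ (ρ + t'))⁻¹, -(((ϖ * σ ϖ) ^ (ρ + t'))⁻¹ * (1 + g)⁻¹)] with hD₁def
  have hV₁ : IsVertexLattice σ ϖ (Matrix.diagonal D₁) 0 (latt (V : Matrix (Fin 3) (Fin 3) K)) :=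
    isVertexLattice_zero_latt_glued_rep hσ hvσ hϖ0 hϖ1 ρ t' hσg hg ht' V hV
  have hD0v : D₁ 0 = ((ϖ * σ ϖ) ^ (ρ + t'))⁻¹ * g := rfl
  have hD1v : D₁ 1 = ((ϖ * σ ϖ) ^ (ρ + t'))⁻¹ := rfl
  have hD2v : D₁ 2 = -(((ϖ * σ ϖ) ^ (ρ + t'))⁻¹ * (1 + g)⁻¹) := rfl
  have hD₁ : ∀ j, σ (D₁ j) = D₁ j ∧ D₁ j ≠ 0 := by
    intro j
    fin_cases j
    · show σ (D₁ 0) = D₁ 0 ∧ D₁ 0 ≠ 0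
      rw [hD0v]
      exact ⟨by rw [map_mul, map_inv₀, hσπ, hσg], mul_ne_zero (inv_ne_zero hπ0) hg0⟩
    · show σ (D₁ 1) = D₁ 1 ∧ D₁ 1 ≠ 0
      rw [hD1v]
      exact ⟨by rw [map_inv₀, hσπ], inv_ne_zero hπ0⟩
    · show σ (D₁ 2) = D₁ 2 ∧ D₁ 2 ≠ 0
      rw [hD2v]
      exact ⟨by rw [map_neg, map_mul, map_inv₀, map_inv₀, hσπ, map_add, map_one, hσg],
        neg_ne_zero.2 (mul_ne_zero (inv_ne_zero hπ0) (inv_ne_zero h1g0))⟩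
  -- the coset structure of the polarisations
  have hcoset : ∀ D : Fin 3 → K, (∀ j, σ (D j) = D j ∧ D j ≠ 0) →
      (IsVertexLattice σ ϖ (Matrix.diagonal D) 0 (latt (V : Matrix (Fin 3) (Fin 3) K)) ↔
        ∃ u ∈ fixedUnitStabilizer σ (latt (V : Matrix (Fin 3) (Fin 3) K)), ∀ j, D j = D₁ j * ((u j : Kˣ) : K)) :=
    fun D hD => fibre_isCoset_zero hvσ ϖ V rfl hn D₁ hD₁ hV₁ D hD
  -- the label and the class function `lam`
  set Λ : Submodule 𝒪[K] (Fin 3 → K) → (Fin 3 → K) → Prop := valueClassLabel σ ϖ (α - 1) (β - 1) (d % 2 + 2 * d - 1) d with hΛdef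
  have hΛeq : IsTorusEquivariantLabel σ Λ := isTorusEquivariantLabel_valueClassLabel σ ϖ (α - 1) (β - 1) (d % 2 + 2 * d - 1) d
  set lam : (Fin 3 → Kˣ) → ℤ := fun u => normSign σ (((u 0 : Kˣ) : K) * g * gα + ((u 1 : Kˣ) : K) * gβ) with hlamdef
  have hlam : ∀ u ∈ fixedUnitStabilizer σ (latt (V : Matrix (Fin 3) (Fin 3) K)), lam u = 1 ∨ lam u = -1 := by
    intro u _
    simp only [hlamdef, normSign]
    split_ifs <;> simp
  have hΛ : ∀ u ∈ fixedUnitStabilizer σ (latt (V : Matrix (Fin 3) (Fin 3) K)), Λ (latt (V : Matrix (Fin 3) (Fin 3) K)) (fun j => D₁ j * ((u j : Kˣ) : K)) ↔ lam u = 1 := by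
    intro u hu
    have hu' := (mem_fixedUnitStabilizer_iff σ _ u).1 hu
    have hσu : ∀ j, σ ((u j : Kˣ) : K) = (u j : Kˣ) := hu'.2.2
    have hvu : ∀ j, Valued.v ((u j : Kˣ) : K) = 1 := hu'.2.1
    have hu0 : ∀ j, ((u j : Kˣ) : K) ≠ 0 := fun j => (u j).ne_zero
    have hM : IsVertexLattice σ ϖ (Matrix.diagonal fun j => D₁ j * ((u j : Kˣ) : K)) 0 (latt (V : Matrix (Fin 3) (Fin 3) K)) :=
      (hcoset _ (fun j => ⟨by rw [map_mul, (hD₁ j).1, hσu], mul_ne_zero (hD₁ j).2 (hu0 j)⟩)).2 ⟨u, hu, fun j => rfl⟩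
    have hgα' : Valued.v ((ϖ ^ (d % 2 + 2 * d - 1))⁻¹ * (((ϖ * σ ϖ) ^ (ρ + t'))⁻¹ * g * ((u 0 : Kˣ) : K) *
        ((α - 1) - gα * ((ϖ - σ ϖ) * ((ϖ * σ ϖ) ^ ((d - d % 2) / 2))⁻¹)))) ≤ 1 := by
      have e : (ϖ ^ (d % 2 + 2 * d - 1))⁻¹ * (((ϖ * σ ϖ) ^ (ρ + t'))⁻¹ * g * ((u 0 : Kˣ) : K) *
          ((α - 1) - gα * ((ϖ - σ ϖ) * ((ϖ * σ ϖ) ^ ((d - d % 2) / 2))⁻¹))) =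
          ((u 0 : Kˣ) : K) * ((ϖ ^ (d % 2 + 2 * d - 1))⁻¹ * (((ϖ * σ ϖ) ^ (ρ + t'))⁻¹ * g *
          ((α - 1) - gα * ((ϖ - σ ϖ) * ((ϖ * σ ϖ) ^ ((d - d % 2) / 2))⁻¹)))) := by ring
      rw [e, map_mul, hvu, one_mul]; exact hgα
    have hgβ' : Valued.v ((ϖ ^ (d % 2 + 2 * d - 1))⁻¹ * (((ϖ * σ ϖ) ^ (ρ + t'))⁻¹ * ((u 1 : Kˣ) : K) *
        ((β - 1) - gβ * ((ϖ - σ ϖ) * ((ϖ * σ ϖ) ^ ((d - d % 2) / 2))⁻¹)))) ≤ 1 := by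
      have e : (ϖ ^ (d % 2 + 2 * d - 1))⁻¹ * (((ϖ * σ ϖ) ^ (ρ + t'))⁻¹ * ((u 1 : Kˣ) : K) *
          ((β - 1) - gβ * ((ϖ - σ ϖ) * ((ϖ * σ ϖ) ^ ((d - d % 2) / 2))⁻¹))) =
          ((u 1 : Kˣ) : K) * ((ϖ ^ (d % 2 + 2 * d - 1))⁻¹ * (((ϖ * σ ϖ) ^ (ρ + t'))⁻¹ *
          ((β - 1) - gβ * ((ϖ - σ ϖ) * ((ϖ * σ ϖ) ^ ((d - d % 2) / 2))⁻¹)))) := by ring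
      rw [e, map_mul, hvu, one_mul]; exact hgβ
    have h := valueClassLabel_glued_rep_class_iff_normSign hD hρ hg1 hg0 V hV hσg (u := fun j => ((u j : Kˣ) : K)) hσu hu0 hn hM hE
      hℓN hmN hℓmc hmmc hlev hnlev hsq hT hTM hσgα hσgβ hgα' hgβ'
    rw [hΛdef]
    exact h
  have hN'le : (unitStabilizer (latt (V : Matrix (Fin 3) (Fin 3) K))).map (unitNormMap σ 3) ≤ fixedUnitStabilizer σ (latt (V : Matrix (Fin 3) (Fin 3) K)) :=
    map_unitNormMap_unitStabilizer_le σ hσ ϖ 0 hD₁ hV₁ hcoset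
  have hlamN : ∀ u ∈ fixedUnitStabilizer σ (latt (V : Matrix (Fin 3) (Fin 3) K)),
      ∀ n ∈ (unitStabilizer (latt (V : Matrix (Fin 3) (Fin 3) K))).map (unitNormMap σ 3), lam (u * n) = lam u := by
    intro u hu n hn
    have h1 := hΛ u hu
    have h2 := hΛ (u * n) (mul_mem hu (hN'le hn))
    have h3 : Λ (latt (V : Matrix (Fin 3) (Fin 3) K)) (fun j => D₁ j * (((u * n) j : Kˣ) : K)) ↔
        Λ (latt (V : Matrix (Fin 3) (Fin 3) K)) (fun j => D₁ j * ((u j : Kˣ) : K)) := by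
      have e : (fun j => D₁ j * (((u * n) j : Kˣ) : K)) = fun j => (D₁ j * ((u j : Kˣ) : K)) * ((n j : Kˣ) : K) :=
        funext fun j => by rw [Pi.mul_apply, Units.val_mul, mul_assoc]
      rw [e]
      exact label_mul_norm_iff_of_isTorusEquivariantLabel hΛeq hn _
    rcases hlam u hu with hu1 | hu1 <;> rcases hlam (u * n) (mul_mem hu (hN'le hn)) with hun | hun
    · rw [hu1, hun]
    · exact absurd (h3.2 (h1.2 hu1)) (fun h => by have := h2.1 h; rw [hun] at this; exact absurd this (by decide))
    · exact absurd (h3.1 (h2.2 hun)) (fun h => by have := h1.1 h; rw [hu1] at this; exact absurd this (by decide))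
    · rw [hu1, hun]
  -- a transversal of `S_F ∕ N′`
  have hfinOrb : {M : Submodule 𝒪[K] (Fin 3 → K) | ∃ u ∈ unitTorus K 3, M = mapGL (diagGLUnits u) (latt (V : Matrix (Fin 3) (Fin 3) K))}.Finite :=
    finite_unitTorus_orbit_of_mem_normalisedStableLattices hϖ (v_diag_eq_one hvσ hE) (diag_regular hE) T hT ⟨⟨V, rfl⟩, hTM, hn⟩
  have hUN := relIndex_map_unitNormMap_unitStabilizer_ne_zero hσ hvσ hσc hcv hc hdich hfinOrb
  have htower : ((unitStabilizer (latt (V : Matrix (Fin 3) (Fin 3) K))).map (unitNormMap σ 3)).relIndex (fixedUnitStabilizer σ (latt (V : Matrix (Fin 3) (Fin 3) K))) *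
      (fixedUnitStabilizer σ (latt (V : Matrix (Fin 3) (Fin 3) K))).relIndex (fixedUnitTorus σ 3) =
      ((unitStabilizer (latt (V : Matrix (Fin 3) (Fin 3) K))).map (unitNormMap σ 3)).relIndex (fixedUnitTorus σ 3) :=
    Subgroup.relIndex_mul_relIndex _ _ _ hN'le (fun u hu => ((mem_fixedUnitStabilizer_iff σ _ u).1 hu).2 |> fun h => (mem_fixedUnitTorus_iff σ u).2 h)
  have hidx : ((unitStabilizer (latt (V : Matrix (Fin 3) (Fin 3) K))).map (unitNormMap σ 3)).relIndex (fixedUnitStabilizer σ (latt (V : Matrix (Fin 3) (Fin 3) K))) ≠ 0 :=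
    fun h => hUN (by rw [← htower, h, zero_mul])
  obtain ⟨R, hRS, hR⟩ := exists_transversal_of_relIndex_ne_zero hidx
  -- the product subgroup and PT-3
  have hN₀ := map_deepRatioSubgroup_le_map_unitStabilizer_glued_rep σ hϖ0 hϖ1.le ρ t' hg V hV hDρ
  obtain ⟨hR₀S, hR₀T⟩ := productTransversal_glued_rep hvσ hϖ0 hϖ1 hρ hσg hg V hV hDρ A₀ Aβ Aγ hA₀sub hA₀ hAγsub hAγ hAβsub hAβ R₀ hR₀
  exact two_mul_card_mul_labelledOddCount_eq_sum_of_classSign hσc hc hdich hD₁ hV₁ hσ hcoset Λ i hlam hlamN hΛ R hRS hR hN₀ R₀ hR₀S hR₀T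

end Rep

end Summit.HodgeConjecture.HodgeConjecture.Cruxes.H413.F0P3cDyRamLabelledOddGluedRepClassSum

end
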